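import Summits.CriticalPhenomena.CardyFormulaZ2.Theorems.CardyBoundaryCoulombGasBoundaryDefectGaussianRStubRigidityOfLocalLawsPart7

/-!
# Stub `stub_matching` of line `excursion-kernel-covariance` (crux `RectilinearCardy`,
# stmt-CriticalPhenomena-5660) — Part 1: walk states and admissibility of a placed `(1,3,1,1; 1)` datum

Geometry-free bookkeeping for `Literature.Probability.LatticeModels.CollarLegModel`.

* **Walk states.** Along a list of darts carrying exactly four insertions — the sink's (three legs,
  sign `+1`) at position `0` and three one-leg sources (sign `-1`) at positions `2 ≤ iA < iB < iC` —
  the state of `WalkState.step` after `t` darts, started from `⟨-3, wired, 0, 0⟩`, is the explicit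
  state `S t` (kept as a hypothesis `hS` on an abstract `S : ℕ → WalkState`): `t = 0`: `⟨-3, wired⟩`;
  `t = 1`: `⟨-2, free, 2 pending, +1⟩`; `2 ≤ t ≤ iA`: `⟨0, free⟩`; `iA < t ≤ iB`: `⟨-1, wired⟩`;
  `iB < t ≤ iC`: `⟨-2, free⟩`; `iC < t`: `⟨-3, wired⟩` (`sm_foldl_eq`). Hence dart `t` lies on a
  wired stretch of level `-1` iff `iA ≤ t ≤ iB`, of level `-3` iff `t = 0 ∨ iC ≤ t`
  (`sm_wired1_iff`, `sm_wired3_iff`).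
* **The literal datum.** The `(1,3,1,1; sink 1)` datum of a placement `p : Fin 4 → ℤ²` has
  `sinkLegs = 3` and, for `p` injective, one leg per source (`sm_sinkLegs`, `sm_legs`).
* **Cycle and placement.** On the boundary cycle `e t = (dsucc V)^[t] d₀` (no repeated dart below
  the period, `s3_cycle_orbit`; a one-outside-neighbour vertex has a unique exterior dart,
  `s3_outDart_of_card`), the placement `p = (C, X, A, B) = ((e iC).1, d₀.1, (e iA).1, (e iB).1)`
  is injective once pairwise `ℓ∞`-separated by `≥ 3` (`sm_sep`, `sm_injective`), and data with
  these points (sources one leg each, `sinkLegs = 3`) is ADMISSIBLE (`sm_admissible`, from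
  `s3_admissible_of_dist` with `G = 3`).
-/

namespace Summit.CriticalPhenomena.CardyFormulaZ2.Cruxes.RectilinearCardy.ExcursionKernelCovariance

open Literature.Probability.LatticeModels Literature.Probability.LatticeModels.CollarLegModel
open Summit.CriticalPhenomena.CardyFormulaZ2.Cruxes.BoundaryDefectGaussianR.RainbowMonomialsInExcursionKernels

/-! ### The states of the walk from the four insertion indices -/

section State

variable {iA iB iC : ℕ} {S : ℕ → WalkState}
  (hS : ∀ t, S t = if t = 0 then ⟨-3, true, 0, 0⟩ else if t = 1 then ⟨-2, false, 2, 1⟩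
    else if t ≤ iA then ⟨0, false, 0, 1⟩ else if t ≤ iB then ⟨-1, true, 0, -1⟩
    else if t ≤ iC then ⟨-2, false, 0, -1⟩ else ⟨-3, true, 0, -1⟩)
include hS

/-- The initial state. [folklore] -/
theorem sm_state_zero : S 0 = ⟨-3, true, 0, 0⟩ := by
  rw [hS, if_pos rfl]

/-- After the sink's junction. [folklore] -/
theorem sm_state_one : S 1 = ⟨-2, false, 2, 1⟩ := by
  rw [hS, if_neg one_ne_zero, if_pos rfl]

/-- After the jump, up to the first source. [folklore] -/
theorem sm_state_free0 {t : ℕ} (h2 : 2 ≤ t) (ht : t ≤ iA) : S t = ⟨0, false, 0, 1⟩ := by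
  rw [hS, if_neg (by omega), if_neg (by omega), if_pos ht]

/-- Between the first and the second source: wired at level `-1`. [folklore] -/
theorem sm_state_wired1 {t : ℕ} (h2 : 2 ≤ iA) (ht : iA < t) (ht' : t ≤ iB) :
    S t = ⟨-1, true, 0, -1⟩ := by
  rw [hS, if_neg (by omega), if_neg (by omega), if_neg (by omega), if_pos ht']

/-- Between the second and the third source: free at level `-2`. [folklore] -/
theorem sm_state_free2 {t : ℕ} (h2 : 2 ≤ iA) (hAB : iA ≤ iB) (ht : iB < t) (ht' : t ≤ iC) :
    S t = ⟨-2, false, 0, -1⟩ := by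
  rw [hS, if_neg (by omega), if_neg (by omega), if_neg (by omega), if_neg (by omega), if_pos ht']

/-- After the third source: wired at level `-3`. [folklore] -/
theorem sm_state_wired3 {t : ℕ} (h2 : 2 ≤ iA) (hAB : iA ≤ iB) (hBC : iB ≤ iC) (ht : iC < t) :
    S t = ⟨-3, true, 0, -1⟩ := by
  rw [hS, if_neg (by omega), if_neg (by omega), if_neg (by omega), if_neg (by omega), if_neg (by omega)]

/-- **One dart of the walk.** With the sink's insertion `(3, +1)` at position `0`, the insertions
`(1, -1)` at positions `iA, iB, iC` and silent darts elsewhere, `S t` steps to `S (t + 1)`. [folklore] -/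
theorem sm_state_step (h2 : 2 ≤ iA) (hAB : iA < iB) (hBC : iB < iC) (t : ℕ) (o : Option (ℕ × ℤ))
    (h0 : t = 0 → o = some (3, 1))
    (hI : t = iA ∨ t = iB ∨ t = iC → o = some (1, -1))
    (hN : t ≠ 0 → t ≠ iA → t ≠ iB → t ≠ iC → o = none) :
    (S t).step o = S (t + 1) := by
  rcases Nat.lt_or_ge t 2 with ht | ht
  · -- the sink's junction, then the jump
    rcases (by omega : t = 0 ∨ t = 1) with rfl | rfl
    · rw [h0 rfl, sm_state_zero hS, sm_state_one hS]; decide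
    · rw [hN (by omega) (by omega) (by omega) (by omega), sm_state_one hS,
        sm_state_free0 hS le_rfl h2]
      decide
  rcases Nat.lt_or_ge t iA with h1 | h1
  · -- silent, free at level `0`
    rw [hN (by omega) (by omega) (by omega) (by omega), sm_state_free0 hS ht h1.le,
      sm_state_free0 hS (by omega) h1]
    decide
  rcases h1.eq_or_lt with h1 | h1
  · -- the first source opens the level `-1` arc
    subst h1
    rw [hI (Or.inl rfl), sm_state_free0 hS ht le_rfl, sm_state_wired1 hS h2 (Nat.lt_succ_self _) hAB]
    decide
  rcases Nat.lt_or_ge t iB with h3 | h3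
  · rw [hN (by omega) (by omega) (by omega) (by omega), sm_state_wired1 hS h2 h1 h3.le,
      sm_state_wired1 hS h2 (by omega) h3]
    decide
  rcases h3.eq_or_lt with h3 | h3
  · -- the second source closes it
    subst h3
    rw [hI (Or.inr (Or.inl rfl)), sm_state_wired1 hS h2 h1 le_rfl,
      sm_state_free2 hS h2 hAB.le (Nat.lt_succ_self _) hBC]
    decide
  rcases Nat.lt_or_ge t iC with h4 | h4
  · rw [hN (by omega) (by omega) (by omega) (by omega), sm_state_free2 hS h2 hAB.le h3 h4.le,
      sm_state_free2 hS h2 hAB.le (by omega) h4]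
    decide
  rcases h4.eq_or_lt with h4 | h4
  · -- the third source opens the level `-3` arc
    subst h4
    rw [hI (Or.inr (Or.inr rfl)), sm_state_free2 hS h2 hAB.le h3 le_rfl,
      sm_state_wired3 hS h2 hAB.le hBC.le (Nat.lt_succ_self _)]
    decide
  · rw [hN (by omega) (by omega) (by omega) (by omega), sm_state_wired3 hS h2 hAB.le hBC.le h4,
      sm_state_wired3 hS h2 hAB.le hBC.le (by omega)]
    decide

/-- **The states along the walk.** For a list of darts whose insertions are `(3, +1)` at position
`0`, `(1, -1)` at positions `iA, iB, iC` (`2 ≤ iA < iB < iC`) and nothing elsewhere, the state after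
`t` darts, started from `⟨-3, wired, 0, 0⟩`, is `S t`. [folklore] -/
theorem sm_foldl_eq (start : Dart → Option (ℕ × ℤ)) (ds : List Dart) (h2 : 2 ≤ iA) (hAB : iA < iB)
    (hBC : iB < iC)
    (h0 : ∀ h : 0 < ds.length, start (ds[0]) = some (3, 1))
    (hI : ∀ (t : ℕ) (ht : t < ds.length), t = iA ∨ t = iB ∨ t = iC → start (ds[t]) = some (1, -1))
    (hN : ∀ (t : ℕ) (ht : t < ds.length), t ≠ 0 → t ≠ iA → t ≠ iB → t ≠ iC → start (ds[t]) = none) :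
    ∀ t : ℕ, t ≤ ds.length →
      List.foldl (fun s d => s.step (start d)) ⟨-3, true, 0, 0⟩ (ds.take t) = S t := by
  intro t
  induction t with
  | zero => intro _; rw [sm_state_zero hS]; rfl
  | succ t ih =>
    intro ht
    rw [foldl_take_succ start _ ds (by omega), ih (by omega)]
    refine sm_state_step hS h2 hAB hBC t _ (fun h => ?_) (fun h => hI t (by omega) h)
      (fun ha hb hc hd => hN t (by omega) ha hb hc hd)
    subst h
    exact h0 (by omega)

/-- **The level `-1` wired stretch** is met exactly by the darts `iA ≤ t ≤ iB` (before or after). [folklore] -/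
theorem sm_wired1_iff (h2 : 2 ≤ iA) (hAB : iA < iB) (hBC : iB < iC) (t : ℕ) :
    (((S t).wired = true ∧ (S t).level = -1) ∨ ((S (t + 1)).wired = true ∧ (S (t + 1)).level = -1)) ↔
      iA ≤ t ∧ t ≤ iB := by
  rw [hS t, hS (t + 1)]
  split_ifs <;> simp <;> first | omega | simp_all

/-- **The level `-3` wired stretch** is met exactly by dart `0` and the darts `iC ≤ t`. [folklore] -/
theorem sm_wired3_iff (h2 : 2 ≤ iA) (hAB : iA < iB) (hBC : iB < iC) (t : ℕ) :
    (((S t).wired = true ∧ (S t).level = -3) ∨ ((S (t + 1)).wired = true ∧ (S (t + 1)).level = -3)) ↔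
      t = 0 ∨ iC ≤ t := by
  rw [hS t, hS (t + 1)]
  split_ifs <;> simp <;> first | omega | simp_all

end State

/-! ### The literal `(1,3,1,1; 1)` datum of a placement `p : Fin 4 → ℤ²` -/

/-- The sink of the `(1,3,1,1; 1)` datum carries `1 + 1 + 1 = 3` legs (whatever the placement). [folklore] -/
theorem sm_sinkLegs (p : Fin 4 → ℤ × ℤ) :
    (⟨(Finset.univ.erase 1).image p, fun x ↦ ∑ i ∈ (Finset.univ.erase 1).filter (fun i ↦ p i = x),
      (![1, 3, 1, 1] : Fin 4 → ℕ) i, p 1⟩ : LegInsertionData).sinkLegs = 3 := by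
  unfold LegInsertionData.sinkLegs
  simp only
  rw [Finset.sum_fiberwise_of_maps_to (fun i hi => Finset.mem_image_of_mem p hi)]
  decide

/-- For an injective placement every source of the `(1,3,1,1; 1)` datum carries exactly one leg. [folklore] -/
theorem sm_legs (p : Fin 4 → ℤ × ℤ) (hp : Function.Injective p) (i : Fin 4) (hi : i ≠ 1) :
    (⟨(Finset.univ.erase 1).image p, fun x ↦ ∑ i ∈ (Finset.univ.erase 1).filter (fun i ↦ p i = x),
      (![1, 3, 1, 1] : Fin 4 → ℕ) i, p 1⟩ : LegInsertionData).legs (p i) = 1 := by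
  have hL : ∀ i : Fin 4, i ≠ 1 → (![1, 3, 1, 1] : Fin 4 → ℕ) i = 1 := by decide
  have hsum : ∑ b ∈ (Finset.univ.erase 1).filter (fun b ↦ p b = p i), (![1, 3, 1, 1] : Fin 4 → ℕ) b =
      (![1, 3, 1, 1] : Fin 4 → ℕ) i :=
    Finset.sum_eq_single_of_mem i
      (Finset.mem_filter.2 ⟨Finset.mem_erase.2 ⟨hi, Finset.mem_univ _⟩, rfl⟩)
      (fun b hb hne => absurd (hp (Finset.mem_filter.1 hb).2) hne)
  exact hsum.trans (hL i hi)

/-- Data with `sinkLegs = 3` starts its walk wired at level `-3` with nothing pending. [folklore] -/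
theorem sm_init {ι : LegInsertionData} (hsl : ι.sinkLegs = 3) : ι.init = ⟨-3, true, 0, 0⟩ := by
  rw [LegInsertionData.init, hsl]; rfl

/-! ### Boundary-cycle facts -/

/-- A vertex with exactly one lattice neighbour outside `V` has any exterior dart at it as its
`outDart`. [folklore] -/
theorem sm_outDart_eq (V : Finset (ℤ × ℤ)) (d : Dart)
    (hcard : ((neighbours d.1).filter (fun y ↦ y ∉ V)).card = 1) (ht : dartTip d ∉ V) :
    outDart V d.1 = some d := by
  obtain ⟨k, hk, -, huniq⟩ := s3_outDart_of_card V d.1 hcard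
  rw [hk, ← huniq d.2 ht]

section Cycle

variable {V : Finset (ℤ × ℤ)} {d₀ : Dart} (hv₀ : d₀.1 ∈ V) (ht₀ : dartTip d₀ ∉ V)
include hv₀ ht₀

/-- Below the period the darts of the boundary cycle are pairwise distinct. [folklore] -/
theorem sm_iter_inj {s t : ℕ} (hs : s < period V d₀) (ht : t < period V d₀)
    (h : (dsucc V)^[s] d₀ = (dsucc V)^[t] d₀) : s = t := by
  obtain ⟨-, -, -, hnodup, -, -⟩ := s3_cycle_orbit V d₀ hv₀ ht₀
  have hlen : (cycle V d₀).length = period V d₀ := by simp [cycle]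
  have hget : ∀ (t : ℕ) (ht : t < (cycle V d₀).length), (cycle V d₀)[t] = (dsucc V)^[t] d₀ := by
    intro t ht; simp [cycle]
  exact (hnodup.getElem_inj_iff (hi := by rw [hlen]; exact hs) (hj := by rw [hlen]; exact ht)).1
    (by rw [hget, hget]; exact h)

/-- A cycle dart at a one-outside-neighbour vertex is that vertex's `outDart`. [folklore] -/
theorem sm_outDart_iter (t : ℕ)
    (hcard : ((neighbours ((dsucc V)^[t] d₀).1).filter (fun y ↦ y ∉ V)).card = 1) :
    outDart V ((dsucc V)^[t] d₀).1 = some ((dsucc V)^[t] d₀) :=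
  sm_outDart_eq V _ hcard ((s3_dsucc_iterate V t).1 d₀ hv₀ ht₀).2

/-- Below the period, two cycle darts at the same one-outside-neighbour vertex coincide. [folklore] -/
theorem sm_idx_eq_of_fst_eq {s t : ℕ} (hs : s < period V d₀) (ht : t < period V d₀)
    (hcard : ((neighbours ((dsucc V)^[s] d₀).1).filter (fun y ↦ y ∉ V)).card = 1)
    (h : ((dsucc V)^[t] d₀).1 = ((dsucc V)^[s] d₀).1) : t = s := by
  have h1 := sm_outDart_iter hv₀ ht₀ s hcard
  have h2 : outDart V ((dsucc V)^[t] d₀).1 = some ((dsucc V)^[t] d₀) :=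
    sm_outDart_eq V _ (h ▸ hcard) ((s3_dsucc_iterate V t).1 d₀ hv₀ ht₀).2
  rw [h, h1] at h2
  exact sm_iter_inj hv₀ ht₀ ht hs (Option.some.inj h2).symm

end Cycle

/-! ### The placement `(C, X, A, B)` on the cycle -/

section Placement

variable {V : Finset (ℤ × ℤ)} {d₀ : Dart} {iA iB iC : ℕ} {p : Fin 4 → ℤ × ℤ}
  (hp : p = ![((dsucc V)^[iC] d₀).1, d₀.1, ((dsucc V)^[iA] d₀).1, ((dsucc V)^[iB] d₀).1])
include hp

/-- The sink of the placement is `X = d₀.1`. [folklore] -/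
theorem sm_p_one : p 1 = d₀.1 := by
  subst hp; rfl

/-- The sources of the placement are the cycle vertices at `iA, iB, iC`. [folklore] -/
theorem sm_p_cases (i : Fin 4) (hi : i ≠ 1) :
    ∃ t, (t = iA ∨ t = iB ∨ t = iC) ∧ p i = ((dsucc V)^[t] d₀).1 := by
  subst hp
  fin_cases i
  · exact ⟨iC, Or.inr (Or.inr rfl), rfl⟩
  · exact absurd rfl hi
  · exact ⟨iA, Or.inl rfl, rfl⟩
  · exact ⟨iB, Or.inr (Or.inl rfl), rfl⟩

/-- Every point of the placement is a cycle vertex at `iC, 0, iA` or `iB`. [folklore] -/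
theorem sm_p_cases' (i : Fin 4) :
    ∃ t, (t = iC ∨ t = 0 ∨ t = iA ∨ t = iB) ∧ p i = ((dsucc V)^[t] d₀).1 := by
  subst hp
  fin_cases i
  · exact ⟨iC, Or.inl rfl, rfl⟩
  · exact ⟨0, Or.inr (Or.inl rfl), rfl⟩
  · exact ⟨iA, Or.inr (Or.inr (Or.inl rfl)), rfl⟩
  · exact ⟨iB, Or.inr (Or.inr (Or.inr rfl)), rfl⟩

/-- The six pairwise `ℓ∞`-separations of `X, A, B, C` give the separation of every ordered pair of
placement points. [folklore] -/
theorem sm_sep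
    (hXA : (3 : ℤ) ≤ max |(d₀.1).1 - (((dsucc V)^[iA] d₀).1).1| |(d₀.1).2 - (((dsucc V)^[iA] d₀).1).2|)
    (hXB : (3 : ℤ) ≤ max |(d₀.1).1 - (((dsucc V)^[iB] d₀).1).1| |(d₀.1).2 - (((dsucc V)^[iB] d₀).1).2|)
    (hXC : (3 : ℤ) ≤ max |(d₀.1).1 - (((dsucc V)^[iC] d₀).1).1| |(d₀.1).2 - (((dsucc V)^[iC] d₀).1).2|)
    (hAB : (3 : ℤ) ≤ max |(((dsucc V)^[iA] d₀).1).1 - (((dsucc V)^[iB] d₀).1).1|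
      |(((dsucc V)^[iA] d₀).1).2 - (((dsucc V)^[iB] d₀).1).2|)
    (hAC : (3 : ℤ) ≤ max |(((dsucc V)^[iA] d₀).1).1 - (((dsucc V)^[iC] d₀).1).1|
      |(((dsucc V)^[iA] d₀).1).2 - (((dsucc V)^[iC] d₀).1).2|)
    (hBC : (3 : ℤ) ≤ max |(((dsucc V)^[iB] d₀).1).1 - (((dsucc V)^[iC] d₀).1).1|
      |(((dsucc V)^[iB] d₀).1).2 - (((dsucc V)^[iC] d₀).1).2|) :
    ∀ a b : Fin 4, a ≠ b → (3 : ℤ) ≤ max |(p a).1 - (p b).1| |(p a).2 - (p b).2| := by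
  have hcomm : ∀ u v : ℤ × ℤ, max |u.1 - v.1| |u.2 - v.2| = max |v.1 - u.1| |v.2 - u.2| :=
    fun u v => by rw [abs_sub_comm u.1, abs_sub_comm u.2]
  subst hp
  intro a b hab
  fin_cases a <;> fin_cases b
  all_goals first | exact absurd rfl hab | skip
  · rw [hcomm]; exact hXC
  · rw [hcomm]; exact hAC
  · rw [hcomm]; exact hBC
  · exact hXC
  · exact hXA
  · exact hXB
  · exact hAC
  · rw [hcomm]; exact hXA
  · exact hAB
  · exact hBC
  · rw [hcomm]; exact hXB
  · rw [hcomm]; exact hAB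

end Placement

/-- Pairwise `ℓ∞`-separated placement points are pairwise distinct. [folklore] -/
theorem sm_injective {p : Fin 4 → ℤ × ℤ}
    (hsep : ∀ a b : Fin 4, a ≠ b → (3 : ℤ) ≤ max |(p a).1 - (p b).1| |(p a).2 - (p b).2|) :
    Function.Injective p := by
  intro a b h
  by_contra hab
  have := hsep a b hab
  rw [h] at this
  simp at this

/-- **Sub-goal (Part 1 of stub M): admissibility of the placed datum** (`s3_admissible_of_dist`,
`G = 3 = sinkLegs`). On the boundary cycle `e t = (dsucc V)^[t] d₀` of the exterior dart `d₀` of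
`X = d₀.1` (`outDart V X = some d₀`), leg-insertion data `ι` with sources `{p 0, p 2, p 3}` carrying
one leg each, sink `p 1` and `sinkLegs = 3`, read off the placement
`p = ((e iC).1, X, (e iA).1, (e iB).1)` whose four points have exactly one outside neighbour and are
pairwise `ℓ∞`-separated by `≥ 3`, is ADMISSIBLE: the points are met by the cycle because they are
cycle darts' vertices (`s3_cycle_orbit`, `s3_dsucc_iterate`). [folklore] -/
theorem sm_admissible :
    ∀ (V : Finset (ℤ × ℤ)) (d₀ : Literature.Probability.LatticeModels.CollarLegModel.Dart) (iA iB iC : ℕ)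
      (p : Fin 4 → ℤ × ℤ) (ι : Literature.Probability.LatticeModels.CollarLegModel.LegInsertionData),
      d₀.1 ∈ V → Literature.Probability.LatticeModels.CollarLegModel.dartTip d₀ ∉ V →
      Literature.Probability.LatticeModels.CollarLegModel.outDart V d₀.1 = some d₀ →
      ((Literature.Probability.LatticeModels.CollarLegModel.neighbours d₀.1).filter (fun y ↦ y ∉ V)).card = 1 →
      ((Literature.Probability.LatticeModels.CollarLegModel.neighbours ((Literature.Probability.LatticeModels.CollarLegModel.dsucc V)^[iA] d₀).1).filter (fun y ↦ y ∉ V)).card = 1 →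
      ((Literature.Probability.LatticeModels.CollarLegModel.neighbours ((Literature.Probability.LatticeModels.CollarLegModel.dsucc V)^[iB] d₀).1).filter (fun y ↦ y ∉ V)).card = 1 →
      ((Literature.Probability.LatticeModels.CollarLegModel.neighbours ((Literature.Probability.LatticeModels.CollarLegModel.dsucc V)^[iC] d₀).1).filter (fun y ↦ y ∉ V)).card = 1 →
      p = ![((Literature.Probability.LatticeModels.CollarLegModel.dsucc V)^[iC] d₀).1, d₀.1, ((Literature.Probability.LatticeModels.CollarLegModel.dsucc V)^[iA] d₀).1, ((Literature.Probability.LatticeModels.CollarLegModel.dsucc V)^[iB] d₀).1] →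
      (∀ a b : Fin 4, a ≠ b → (3 : ℤ) ≤ max |(p a).1 - (p b).1| |(p a).2 - (p b).2|) →
      ι.source = (Finset.univ.erase 1).image p → (∀ i : Fin 4, i ≠ 1 → ι.legs (p i) = 1) →
      ι.sink = p 1 → ι.sinkLegs = 3 → ι.IsAdmissible V := by
  intro V d₀ iA iB iC p ι hv₀ ht₀ hout hcX hcA hcB hcC hp hsep hsrc hlegs hsink hsl
  have hinj := sm_injective hsep
  obtain ⟨-, -, hall, -, -, -⟩ := s3_cycle_orbit V d₀ hv₀ ht₀
  have hcard : ∀ t, (t = iC ∨ t = 0 ∨ t = iA ∨ t = iB) →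
      ((neighbours ((dsucc V)^[t] d₀).1).filter (fun y ↦ y ∉ V)).card = 1 := by
    rintro t (rfl | rfl | rfl | rfl)
    exacts [hcC, hcX, hcA, hcB]
  have hmem : ∀ x ∈ insert ι.sink ι.source, ∃ i, x = p i := by
    intro x hx
    rw [hsink, hsrc, Finset.mem_insert, Finset.mem_image] at hx
    rcases hx with rfl | ⟨i, -, rfl⟩
    exacts [⟨1, rfl⟩, ⟨i, rfl⟩]
  have hout' : outDart V ι.sink = some d₀ := by rw [hsink, sm_p_one hp]; exact hout
  refine s3_admissible_of_dist ι V d₀ 3 ?_ (fun x hx => ?_) (fun h => ?_) hout' (fun x hx => ?_) hsl.le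
    (fun x hx x' hx' hne => ?_)
  · rw [hsrc]
    exact ⟨p 0, Finset.mem_image_of_mem p (Finset.mem_erase.2 ⟨by decide, Finset.mem_univ _⟩)⟩
  · rw [hsrc] at hx
    obtain ⟨i, hi, rfl⟩ := Finset.mem_image.1 hx
    rw [hlegs i (Finset.mem_erase.1 hi).1]
  · rw [hsink, hsrc] at h
    obtain ⟨i, hi, he⟩ := Finset.mem_image.1 h
    exact (Finset.mem_erase.1 hi).1 (hinj he)
  · obtain ⟨i, rfl⟩ := hmem x hx
    obtain ⟨t, ht4, hpt⟩ := sm_p_cases' hp i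
    rw [hpt]
    exact ⟨((s3_dsucc_iterate V t).1 d₀ hv₀ ht₀).1, hcard t ht4, _, hall t, rfl⟩
  · obtain ⟨a, rfl⟩ := hmem x hx
    obtain ⟨b, rfl⟩ := hmem x' hx'
    have hab : a ≠ b := fun h => hne (h ▸ rfl)
    exact_mod_cast hsep a b hab


end Summit.CriticalPhenomena.CardyFormulaZ2.Cruxes.RectilinearCardy.ExcursionKernelCovariance
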